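import Mathlib.RingTheory.SimpleModule.Isotypic
import Mathlib.RepresentationTheory.AlgebraRepresentation.Basic
import Mathlib.RepresentationTheory.Irreducible
import Mathlib.LinearAlgebra.Matrix.Kronecker
import Mathlib.LinearAlgebra.Matrix.ToLin
import Mathlib.LinearAlgebra.StdBasis
import Mathlib.LinearAlgebra.FiniteDimensional.Basic
import Summits.Langlands.Langlands.Theorems.CliffordTateStructureCliffordCore
import HarnessLib

/-!
# Clifford–Tate structure: the Kronecker frame of an isotypic restriction

Pure algebra behind the isotypic branch of Clifford theory.  Let `π : G → GL(V)` be a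
representation over an algebraically closed field `k`, `N ◁ G` normal, and suppose the restriction
`π|_N` is ISOTYPIC: `V|_N ≅ S^{⊕ d}` with `S` a simple `k[N]`-module (`IsIsotypic.linearEquiv_fun`).
In the basis `B(x, j) :=` "`x`-th basis vector of the `j`-th copy of `S`" every `π(g)` is a
KRONECKER PRODUCT `X(g) ⊗ Y(g)` (`exists_kroneckerFrame`): the blocks
`p_l ∘ π(g) ∘ ι_j : S → S` are `N`-equivariant up to the twist `n ↦ g n g⁻¹`, and the space of such
twisted-equivariant maps is at most one-dimensional (Schur's lemma, `exists_eq_smul_of_twist`).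
For `n ∈ N` the Kronecker factor `Y(n)` is `1`; `d = 1` forces `π|_N` irreducible and
`dim S = 1` forces `N` to act by scalars.

* `Submodule.ofStableSubspace`, `LinearMap.ofCommute` — a `k`-subspace stable under `N`
  (a `k`-linear map commuting with `N`) is a `k[N]`-submodule (a `k[N]`-linear map);
* `exists_eq_smul_of_twist` — twisted Schur;
* `copyIn`, `copyOut`, `kronBasis` (+ API) — the copies of `S` in `V` and the Kronecker basis;
* `exists_kroneckerFrame` — the structure theorem above.
[cite: Clifford1937, Thm. 2–3] [cite: Zarhin2005Clifford, §3]
[cite: SerreLinearRepresentations1977, §8.1]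
-/

set_option autoImplicit false
set_option linter.dupNamespace false

noncomputable section

namespace Summit.Langlands.Langlands.Theorems

open Module

/-! ### `k[N]`-structures from `N`-stable `k`-structures -/

section ModuleHelpers

variable {k : Type*} [Field k] {N₀ : Type*} [Group N₀]
  {S₁ : Type*} [AddCommGroup S₁] [Module k S₁] [Module (MonoidAlgebra k N₀) S₁]
  [IsScalarTower k (MonoidAlgebra k N₀) S₁]
  {S₂ : Type*} [AddCommGroup S₂] [Module k S₂] [Module (MonoidAlgebra k N₀) S₂]
  [IsScalarTower k (MonoidAlgebra k N₀) S₂]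

/-- A `k`-subspace stable under the group elements is a `k[N]`-submodule. [folklore] -/
def Submodule.ofStableSubspace (T : Submodule k S₁)
    (hT : ∀ (n : N₀) (s : S₁), s ∈ T → MonoidAlgebra.of k N₀ n • s ∈ T) :
    Submodule (MonoidAlgebra k N₀) S₁ where
  carrier := T
  zero_mem' := T.zero_mem
  add_mem' := T.add_mem
  smul_mem' := by
    intro a s hs
    refine MonoidAlgebra.induction_on (p := fun a => a • s ∈ T) a (fun n => hT n s hs)
      (fun x y hx hy => ?_) (fun r x hx => ?_)
    · change (x + y) • s ∈ T
      rw [add_smul]; exact T.add_mem hx hy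
    · change (r • x) • s ∈ T
      rw [smul_assoc]; exact T.smul_mem r hx

/-- Membership in `Submodule.ofStableSubspace T hT` is membership in `T`. [folklore] -/
theorem Submodule.mem_ofStableSubspace {T : Submodule k S₁}
    {hT : ∀ (n : N₀) (s : S₁), s ∈ T → MonoidAlgebra.of k N₀ n • s ∈ T} {s : S₁} :
    s ∈ Submodule.ofStableSubspace T hT ↔ s ∈ T := Iff.rfl

/-- A `k`-linear map commuting with the group elements is `k[N]`-linear. [folklore] -/
def LinearMap.ofCommute (f : S₁ →ₗ[k] S₂)
    (hf : ∀ (n : N₀) (s : S₁), f (MonoidAlgebra.of k N₀ n • s) = MonoidAlgebra.of k N₀ n • f s) :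
    S₁ →ₗ[MonoidAlgebra k N₀] S₂ where
  toFun := f
  map_add' := f.map_add
  map_smul' := by
    intro a s
    refine MonoidAlgebra.induction_on
      (p := fun a => f (a • s) = (RingHom.id (MonoidAlgebra k N₀)) a • f s) a (fun n => hf n s)
      (fun x y hx hy => ?_) (fun r x hx => ?_)
    · simp only [RingHom.id_apply] at hx hy ⊢
      simp only [add_smul, map_add, hx, hy]
    · simp only [RingHom.id_apply] at hx ⊢
      rw [smul_assoc, f.map_smul, hx, smul_assoc]

/-- `LinearMap.ofCommute f hf` acts as `f`. [folklore] -/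
@[simp] theorem LinearMap.ofCommute_apply (f : S₁ →ₗ[k] S₂)
    (hf : ∀ (n : N₀) (s : S₁), f (MonoidAlgebra.of k N₀ n • s) = MonoidAlgebra.of k N₀ n • f s)
    (s : S₁) : LinearMap.ofCommute f hf s = f s := rfl

/-- **Twisted Schur.**  `S` a simple `k[N]`-module, finite-dimensional over the algebraically closed
`k`; if `f, f' : S → S` are `k`-linear and `N`-equivariant up to the SAME twist `τ : N → N`
(`f(n • s) = τ(n) • f(s)`), and `f' ≠ 0`, then `f = c • f'` for a scalar `c` (`f'` is injective as
its kernel is an `N`-stable subspace, hence bijective, and `f'⁻¹ ∘ f` commutes with `N`).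
[cite: SerreLinearRepresentations1977, §2.2 Prop. 4] -/
theorem exists_eq_smul_of_twist [IsAlgClosed k] [IsSimpleModule (MonoidAlgebra k N₀) S₁]
    [FiniteDimensional k S₁] (τ : N₀ → N₀) (f f' : S₁ →ₗ[k] S₁)
    (hf : ∀ (n : N₀) (s : S₁), f (MonoidAlgebra.of k N₀ n • s) = MonoidAlgebra.of k N₀ (τ n) • f s)
    (hf' : ∀ (n : N₀) (s : S₁),
      f' (MonoidAlgebra.of k N₀ n • s) = MonoidAlgebra.of k N₀ (τ n) • f' s)
    (h0 : f' ≠ 0) : ∃ c : k, f = c • f' := by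
  -- `f'` is injective: its kernel is an `N`-stable subspace of the simple module `S`
  have hker : ∀ (n : N₀) (s : S₁), s ∈ LinearMap.ker f' →
      MonoidAlgebra.of k N₀ n • s ∈ LinearMap.ker f' := by
    intro n s hs
    rw [LinearMap.mem_ker] at hs ⊢
    rw [hf', hs, smul_zero]
  have hinj : Function.Injective f' := by
    rcases eq_bot_or_eq_top (Submodule.ofStableSubspace (LinearMap.ker f') hker) with h | h
    · rw [← LinearMap.ker_eq_bot, eq_bot_iff]
      intro s hs
      have h1 : s ∈ Submodule.ofStableSubspace (LinearMap.ker f') hker := hs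
      rw [h] at h1
      exact h1
    · exfalso
      apply h0
      ext s
      have h1 : s ∈ Submodule.ofStableSubspace (LinearMap.ker f') hker := by
        rw [h]; exact Submodule.mem_top
      exact h1
  have hbij : Function.Bijective f' := ⟨hinj, LinearMap.injective_iff_surjective.1 hinj⟩
  let e' : S₁ ≃ₗ[k] S₁ := LinearEquiv.ofBijective f' hbij
  have he' : ∀ s, e' s = f' s := fun s => rfl
  -- `g := f'⁻¹ ∘ f` commutes with `N`
  let g : S₁ →ₗ[k] S₁ := e'.symm.toLinearMap ∘ₗ f
  have hg : ∀ (n : N₀) (s : S₁),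
      g (MonoidAlgebra.of k N₀ n • s) = MonoidAlgebra.of k N₀ n • g s := by
    intro n s
    change e'.symm (f _) = MonoidAlgebra.of k N₀ n • e'.symm (f s)
    rw [hf, LinearEquiv.symm_apply_eq, he', hf', ← he', LinearEquiv.apply_symm_apply]
  obtain ⟨c, hc⟩ :=
    (IsSimpleModule.algebraMap_end_bijective_of_isAlgClosed k
      (A := MonoidAlgebra k N₀) (V := S₁)).2 (LinearMap.ofCommute g hg)
  refine ⟨c, ?_⟩
  ext s
  have h1 : g s = c • s := by
    have h2 := congrArg (fun φ => φ s) hc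
    simp only [Module.algebraMap_end_apply, LinearMap.ofCommute_apply] at h2
    exact h2.symm
  have h3 : f s = e' (g s) := by
    change f s = e' (e'.symm (f s))
    rw [LinearEquiv.apply_symm_apply]
  rw [h3, h1, map_smul, he', LinearMap.smul_apply]

end ModuleHelpers

/-! ### The copies of `S` inside `V` and the Kronecker basis -/

section Frame

variable {k : Type*} [Field k] {G : Type*} [Group G] {V : Type*} [AddCommGroup V] [Module k V]
  (π : Representation k G V) (N : Subgroup G)
  {d : ℕ} {S : Submodule (MonoidAlgebra k N) (resN π N).asModule}
  (ψ : (resN π N).asModule ≃ₗ[MonoidAlgebra k N] (Fin d → S))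

/-- The `j`-th copy `S → V` of the simple constituent. [folklore] -/
def copyIn (j : Fin d) : S →ₗ[k] V :=
  (resN π N).asModuleEquiv.toLinearMap ∘ₗ (ψ.symm.restrictScalars k).toLinearMap ∘ₗ
    LinearMap.single k (fun _ : Fin d => (S : Type _)) j

/-- The projection `V → S` onto the `l`-th copy. [folklore] -/
def copyOut (l : Fin d) : V →ₗ[k] S :=
  (LinearMap.proj l : (Fin d → S) →ₗ[k] S) ∘ₗ (ψ.restrictScalars k).toLinearMap ∘ₗ
    (resN π N).asModuleEquiv.symm.toLinearMap

/-- Formula for `copyIn`. [folklore] -/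
theorem copyIn_apply (j : Fin d) (s : S) :
    copyIn π N ψ j s = (resN π N).asModuleEquiv (ψ.symm (Pi.single j s)) := rfl

/-- Formula for `copyOut`. [folklore] -/
theorem copyOut_apply (l : Fin d) (v : V) :
    copyOut π N ψ l v = ψ ((resN π N).asModuleEquiv.symm v) l := rfl

/-- `copyOut l ∘ copyIn j` is the identity if `l = j` and zero otherwise. [folklore] -/
theorem copyOut_copyIn (l j : Fin d) (s : S) :
    copyOut π N ψ l (copyIn π N ψ j s) = if l = j then s else 0 := by
  rw [copyOut_apply, copyIn_apply, LinearEquiv.symm_apply_apply, LinearEquiv.apply_symm_apply,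
    Pi.single_apply]

/-- `v = ∑ⱼ copyIn j (copyOut j v)`. [folklore] -/
theorem sum_copyIn_copyOut (v : V) : ∑ j, copyIn π N ψ j (copyOut π N ψ j v) = v := by
  simp only [copyIn_apply, copyOut_apply]
  rw [← map_sum, ← map_sum, Finset.univ_sum_single, LinearEquiv.symm_apply_apply,
    LinearEquiv.apply_symm_apply]

/-- `N` acts on the copies through its action on `S`. [folklore] -/
theorem apply_copyIn (n : N) (j : Fin d) (s : S) :
    π (n : G) (copyIn π N ψ j s) = copyIn π N ψ j (MonoidAlgebra.of k N n • s) := by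
  rw [copyIn_apply, copyIn_apply, Pi.single_smul, map_smul, Representation.asModuleEquiv_map_smul,
    Representation.asAlgebraHom_of]
  rfl

/-- `copyOut l` is `N`-equivariant: `copyOut l (π n v) = n • copyOut l v`. [folklore] -/
theorem copyOut_apply_apply (n : N) (l : Fin d) (v : V) :
    copyOut π N ψ l (π (n : G) v) = MonoidAlgebra.of k N n • copyOut π N ψ l v := by
  rw [copyOut_apply, copyOut_apply]
  have h1 : π (n : G) v = (resN π N) n v := rfl
  rw [h1, Representation.asModuleEquiv_symm_map_rho, map_smul, Pi.smul_apply]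

/-- The `(l, j)` block `S → S` of `π(g)` is `N`-equivariant up to the twist `n ↦ g n g⁻¹`.
[folklore] -/
theorem block_twist [N.Normal] (g : G) (l j : Fin d) (n : N) (s : S) :
    (copyOut π N ψ l ∘ₗ π g ∘ₗ copyIn π N ψ j) (MonoidAlgebra.of k N n • s) =
      MonoidAlgebra.of k N ⟨g * n * g⁻¹, Subgroup.Normal.conj_mem inferInstance _ n.2 g⟩ •
        (copyOut π N ψ l ∘ₗ π g ∘ₗ copyIn π N ψ j) s := by
  simp only [LinearMap.coe_comp, Function.comp_apply]
  rw [← apply_copyIn, ← copyOut_apply_apply]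
  congr 1
  change π g (π (n : G) _) = π (g * n * g⁻¹) (π g _)
  rw [← Module.End.mul_apply, ← map_mul, ← Module.End.mul_apply (f := π (g * n * g⁻¹)),
    ← map_mul, inv_mul_cancel_right]

/-- Some block of `π(g)` is nonzero (if `V ≠ 0`). [folklore] -/
theorem exists_block_ne_zero [Nontrivial V] (g : G) :
    ∃ l j : Fin d, copyOut π N ψ l ∘ₗ π g ∘ₗ copyIn π N ψ j ≠ 0 := by
  by_contra h
  push Not at h
  obtain ⟨v, hv⟩ := exists_ne (0 : V)
  apply hv
  have h1 : π g v = 0 := by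
    rw [← sum_copyIn_copyOut π N ψ v, map_sum]
    refine Finset.sum_eq_zero fun j _ => ?_
    rw [← sum_copyIn_copyOut π N ψ (π g (copyIn π N ψ j _))]
    refine Finset.sum_eq_zero fun l _ => ?_
    have h2 := LinearMap.congr_fun (h l j) (copyOut π N ψ j v)
    simp only [LinearMap.coe_comp, Function.comp_apply, LinearMap.zero_apply] at h2
    rw [h2, map_zero]
  have h3 : π g⁻¹ (π g v) = v := by
    rw [← Module.End.mul_apply, ← map_mul, inv_mul_cancel, map_one, Module.End.one_apply]
  rw [← h3, h1, map_zero]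

variable {a : ℕ} (bS : Module.Basis (Fin a) k S)

/-- The Kronecker basis `B(x, j) = ι_j(b_x)` of `V`. [folklore] -/
def kronBasis : Module.Basis (Fin a × Fin d) k V :=
  ((Pi.basis fun _ : Fin d => bS).reindex
      ((Equiv.sigmaEquivProd (Fin d) (Fin a)).trans (Equiv.prodComm (Fin d) (Fin a)))).map
    ((ψ.symm.restrictScalars k).trans (resN π N).asModuleEquiv)

/-- Coordinates in the Kronecker basis: `(kronBasis).repr v (y, l) = bS.repr (copyOut l v) y`. [folklore] -/
theorem kronBasis_repr (v : V) (y : Fin a) (l : Fin d) :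
    (kronBasis π N ψ bS).repr v (y, l) = bS.repr (copyOut π N ψ l v) y := by
  simp only [kronBasis, Module.Basis.map_repr, LinearEquiv.trans_apply,
    Module.Basis.repr_reindex_apply, Pi.basis_repr, copyOut_apply]
  rfl

/-- Matrix entries in the Kronecker basis are the entries of the blocks. [folklore] -/
theorem toMatrix_kronBasis [DecidableEq (Fin a × Fin d)] (f : V →ₗ[k] V) (y : Fin a) (l : Fin d)
    (x : Fin a) (j : Fin d) :
    LinearMap.toMatrix (kronBasis π N ψ bS) (kronBasis π N ψ bS) f (y, l) (x, j) =
      LinearMap.toMatrix bS bS (copyOut π N ψ l ∘ₗ f ∘ₗ copyIn π N ψ j) y x := by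
  rw [LinearMap.toMatrix_apply, LinearMap.toMatrix_apply, kronBasis_repr]
  congr 2
  simp only [kronBasis, Module.Basis.map_apply, Module.Basis.reindex_apply, LinearEquiv.trans_apply,
    LinearMap.coe_comp, Function.comp_apply, copyIn_apply]
  congr 2
  rw [Pi.basis_apply]
  rfl

end Frame

/-! ### The Kronecker frame theorem -/

section Main

variable {k : Type*} [Field k] {G : Type*} [Group G] {V : Type*} [AddCommGroup V] [Module k V]
  (π : Representation k G V) (N : Subgroup G)

set_option maxHeartbeats 800000 in
/-- **Kronecker frame of an isotypic restriction (Clifford).**  `k` algebraically closed, `N ◁ G`,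
`π` irreducible and finite-dimensional (so `π|_N` is semisimple), `π|_N` isotypic.  There are `a, d ≥ 1` and a basis `B` of `V` indexed
by `Fin a × Fin d` in which every `π(g)` is a Kronecker product `X(g) ⊗ Y(g)`, every `π(n)`,
`n ∈ N`, is `X(n) ⊗ 1`; moreover `d = 1` forces `π|_N` irreducible and `a = 1` forces `N` to act by
scalars. [cite: Clifford1937, Thm. 2–3] [cite: Zarhin2005Clifford, §3] -/
theorem exists_kroneckerFrame [IsAlgClosed k] [FiniteDimensional k V] [π.IsIrreducible] [N.Normal]
    (hiso : IsIsotypic (MonoidAlgebra k N) (resN π N).asModule) :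
    ∃ (a d : ℕ) (B : Module.Basis (Fin a × Fin d) k V), 0 < a ∧ 0 < d ∧
      (∀ g : G, ∃ (X : Matrix (Fin a) (Fin a) k) (Y : Matrix (Fin d) (Fin d) k),
        LinearMap.toMatrix B B (π g) = Matrix.kroneckerMap (· * ·) X Y) ∧
      (∀ n ∈ N, ∃ X : Matrix (Fin a) (Fin a) k,
        LinearMap.toMatrix B B (π n) = Matrix.kroneckerMap (· * ·) X 1) ∧
      (d = 1 → (resN π N).IsIrreducible) ∧
      (a = 1 → ∀ n ∈ N, ∃ c : k, π n = c • LinearMap.id) := by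
  classical
  haveI : Nontrivial V := (subsingleton_or_nontrivial V).resolve_left fun hV =>
    IsSimpleOrder.bot_ne_top (α := Subrepresentation π)
      (Subrepresentation.toSubmodule_injective (Subsingleton.elim _ _))
  haveI : Module.Finite (MonoidAlgebra k N) (resN π N).asModule :=
    Module.Finite.of_restrictScalars_finite k _ _
  haveI : Nontrivial (resN π N).asModule := (inferInstance : Nontrivial V)
  haveI := isSemisimpleModule_asModule_restrict (π := π) (N := N)
  obtain ⟨d, hd, S, hS, ⟨ψ⟩⟩ := hiso.linearEquiv_fun
  haveI := hS
  haveI : FiniteDimensional k S :=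
    Module.Finite.of_injective (S.subtype.restrictScalars k) Subtype.val_injective
  let bS := Module.finBasis k S
  refine ⟨Module.finrank k S, d, kronBasis π N ψ bS, ?_, Nat.pos_of_ne_zero hd.ne, ?_, ?_, ?_, ?_⟩
  · -- `S ≠ 0`
    haveI : Nontrivial S := IsSimpleModule.nontrivial (MonoidAlgebra k N) S
    exact Module.finrank_pos
  · -- every `π(g)` is a Kronecker product
    intro g
    obtain ⟨l₀, j₀, h0⟩ := exists_block_ne_zero π N ψ g
    set f₀ := copyOut π N ψ l₀ ∘ₗ π g ∘ₗ copyIn π N ψ j₀ with hf₀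
    have hc : ∀ l j : Fin d, ∃ c : k, copyOut π N ψ l ∘ₗ π g ∘ₗ copyIn π N ψ j = c • f₀ :=
      fun l j => exists_eq_smul_of_twist _ _ f₀ (block_twist π N ψ g l j)
        (block_twist π N ψ g l₀ j₀) h0
    choose c hc using hc
    refine ⟨LinearMap.toMatrix bS bS f₀, Matrix.of fun l j => c l j, ?_⟩
    ext ⟨y, l⟩ ⟨x, j⟩
    rw [toMatrix_kronBasis, hc l j, map_smul, Matrix.kroneckerMap_apply, Matrix.smul_apply,
      Matrix.of_apply, smul_eq_mul, mul_comm]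
  · -- `π(n) = X(n) ⊗ 1`
    intro n hn
    let nS : S →ₗ[k] S :=
      { toFun := fun s => MonoidAlgebra.of k N ⟨n, hn⟩ • s
        map_add' := fun s t => smul_add _ s t
        map_smul' := fun r s => by rw [RingHom.id_apply, smul_comm] }
    refine ⟨LinearMap.toMatrix bS bS nS, ?_⟩
    ext ⟨y, l⟩ ⟨x, j⟩
    rw [toMatrix_kronBasis, Matrix.kroneckerMap_apply, LinearMap.toMatrix_apply,
      LinearMap.toMatrix_apply]
    simp only [LinearMap.coe_comp, Function.comp_apply]
    have h1 : π n (copyIn π N ψ j (bS x)) = copyIn π N ψ j (nS (bS x)) :=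
      apply_copyIn π N ψ ⟨n, hn⟩ j (bS x)
    rw [h1, copyOut_copyIn]
    by_cases hlj : l = j
    · subst hlj; simp
    · simp [hlj]
  · -- `d = 1 ⇒ π|_N` irreducible
    intro hd1
    subst hd1
    haveI : IsSimpleModule (MonoidAlgebra k N) (resN π N).asModule :=
      IsSimpleModule.congr (ψ.trans (LinearEquiv.funUnique (Fin 1) (MonoidAlgebra k N) S))
    exact (Representation.irreducible_iff_isSimpleModule_asModule _).2 inferInstance
  · -- `a = 1 ⇒ N` acts by scalars
    intro ha n hn
    haveI : Nontrivial S := IsSimpleModule.nontrivial (MonoidAlgebra k N) S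
    obtain ⟨s₀, hs₀⟩ := exists_ne (0 : S)
    obtain ⟨c, hc⟩ := (finrank_eq_one_iff_of_nonzero' s₀ hs₀).1 ha
      (MonoidAlgebra.of k N ⟨n, hn⟩ • s₀)
    have hsc : ∀ s : S, MonoidAlgebra.of k N ⟨n, hn⟩ • s = c • s := by
      intro s
      obtain ⟨r, rfl⟩ := (finrank_eq_one_iff_of_nonzero' s₀ hs₀).1 ha s
      rw [smul_comm, ← hc, smul_comm]
    refine ⟨c, ?_⟩
    ext v
    rw [LinearMap.smul_apply, LinearMap.id_apply, ← sum_copyIn_copyOut π N ψ v, map_sum,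
      Finset.smul_sum]
    refine Finset.sum_congr rfl fun j _ => ?_
    rw [apply_copyIn π N ψ ⟨n, hn⟩, hsc, map_smul]

end Main

end Summit.Langlands.Langlands.Theorems

end
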